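import Literature.RingTheory.FormalGroups.LazardTheorem
import Literature.RingTheory.FormalGroups.FormalGroupHom
import HarnessLib

/-!
# Crux `HLiu418` — P6 «MOD programme» SUB-LINE F0-P6d LubinTateFormalModuli, STUB (c1) `stub_L4B3c1 : StubC1TypicalUniversal p`
# — by LAZARD'S THEOREM (road c1-B): one universal commutative law over `ℤ[T₀, T₁, …]`, `ψ = X`, the hypothesis on `p` idle

HC_CM is proved only modulo the printed citations until rung 0 closes.  Cell `hodgecm-mathlib`, floor 0, programme P6, sub-line
skeleton `Cruxes/HLiu418/Lines/F0_P6d_LubinTateFormalModuli.lean` (F0P6d-plan (g0), ED. 2 b61911ed76ed3d88), registered stub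
`theorem stub_L4B3c1 (p : ℕ) [Fact p.Prime] : StubC1TypicalUniversal.{u} p`.  This file proves `stubC1TypicalUniversal_holds`,
whose statement is the body of `StubC1TypicalUniversal p` BINDER FOR BINDER (nothing imports the Lines module); the registrar's
fold is `stub_L4B3c1 p := stubC1TypicalUniversal_holds p` (the `Fact p.Prime` instance and the hypothesis `IsNilpotent (p : B)`
are idle: Lazard's theorem needs neither).  THEOREMS ONLY; no definition, no instance, no `sorry`.

The mathematics is ★ `Literature/RingTheory/FormalGroups/LazardTheorem.lean` (this seat's organs `LazardRing` → `AdditiveLawDeformation`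
→ `LazardRingGrading` → `LazardRingLinearisation` → `LazardRingGenerators` → `LazardLogLaw` → `LazardTheorem`, over ★ p01∕p05
`SymmetricCocycleLemma`∕`CocyclePolynomial` and ★ B-p18 `FormalGroupStrictIsoTransport`): the Lazard ring is `ℤ[T₀, T₁, …]`
(`LazardRing.equivMvPolynomial`), the universal commutative one-dimensional law `LazardRing.univLawPoly` lives over
`MvPolynomial ℕ ℤ`, and every commutative law `G` over any commutative ring `B` is `univLawPoly.map f` for a (unique) ring map
`f : ℤ[T] → B` (`LazardRing.exists_map_univLawPoly_eq`); the strict isomorphism asked for is the identity series `X`.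

## References
* [Lazard1955] M. Lazard, *Sur les groupes de Lie formels à un paramètre*, Bull. SMF 83 (1955), Théorème II (p. 254), §III.
* [Hazewinkel1978] M. Hazewinkel, *Formal Groups and Applications* (1978), §5 (Thm. 5.3.8, §5.5).
-/

set_option autoImplicit false
set_option linter.dupNamespace false -- the mandated namespace repeats `HodgeConjecture.HodgeConjecture`

noncomputable section

namespace Summit.HodgeConjecture.HodgeConjecture.Cruxes.HLiu418.F0P6dLubinTateStubC1

open Literature.RingTheory.FormalGroups (FormalGroupHom)
open Literature.RingTheory.FormalGroups.LazardRing (univLawPoly univLawPoly_isComm exists_map_univLawPoly_eq)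

universe u

/-- **The identity series is a strict isomorphism `G → H` whenever `H = G`** (plumbing for the fold: the law `G` IS the
base change `H₀.map f`, so `ψ = X`). [cite: Hazewinkel1978, §1.2 Def. (1.2.1)] -/
theorem exists_strictIso_of_eq {B : Type u} [CommRing B] {G H : FormalGroup B} (h : H = G) :
    ∃ ψ : FormalGroupHom G H, PowerSeries.coeff 1 ψ.toPowerSeries = 1 := by
  subst h
  exact ⟨FormalGroupHom.id _, by rw [FormalGroupHom.id_toPowerSeries, PowerSeries.coeff_one_X]⟩

/-- **STUB (c1) `stub_L4B3c1 : StubC1TypicalUniversal p` of `Lines/F0_P6d_LubinTateFormalModuli.lean` — its body BINDER FOR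
BINDER, for EVERY `p : ℕ`** (LAZARD road c1-B: the hypothesis `IsNilpotent (p : B)` is not used).  There is ONE commutative
one-dimensional formal group law `H₀` over `MvPolynomial ℕ ℤ = ℤ[T₀, T₁, …]` — Lazard's universal law ★ `LazardRing.univLawPoly` —
such that every commutative law `G` over every commutative ring `B` is STRICTLY ISOMORPHIC (indeed EQUAL, `ψ = X`) to a base
change `H₀.map f`, `f : ℤ[T] → B` the classifying map of `G` (★ `LazardRing.exists_map_univLawPoly_eq`, Lazard's Théorème II).
Fold: `stub_L4B3c1 p := stubC1TypicalUniversal_holds p`. [cite: Lazard1955, Théorème II (p. 254)] -/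
theorem stubC1TypicalUniversal_holds (p : ℕ) :
    ∃ H₀ : FormalGroup (MvPolynomial ℕ ℤ), H₀.IsComm ∧
      ∀ (B : Type u) [CommRing B], IsNilpotent (p : B) →
        ∀ (G : FormalGroup B), G.IsComm →
          ∃ (f : MvPolynomial ℕ ℤ →+* B) (ψ : FormalGroupHom G (H₀.map f)), PowerSeries.coeff 1 ψ.toPowerSeries = 1 := by
  refine ⟨univLawPoly, univLawPoly_isComm, fun B _ _ G hG => ?_⟩
  haveI := hG
  obtain ⟨f, hf⟩ := exists_map_univLawPoly_eq G
  obtain ⟨ψ, hψ⟩ := exists_strictIso_of_eq hf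
  exact ⟨f, ψ, hψ⟩

/-- The same for a prime `p` with the `Fact p.Prime` instance of the registered stub (idle). [cite: Lazard1955, Théorème II (p. 254)] -/
theorem stubC1TypicalUniversal_holds_of_prime (p : ℕ) [Fact p.Prime] :
    ∃ H₀ : FormalGroup (MvPolynomial ℕ ℤ), H₀.IsComm ∧
      ∀ (B : Type u) [CommRing B], IsNilpotent (p : B) →
        ∀ (G : FormalGroup B), G.IsComm →
          ∃ (f : MvPolynomial ℕ ℤ →+* B) (ψ : FormalGroupHom G (H₀.map f)), PowerSeries.coeff 1 ψ.toPowerSeries = 1 :=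
  stubC1TypicalUniversal_holds p

end Summit.HodgeConjecture.HodgeConjecture.Cruxes.HLiu418.F0P6dLubinTateStubC1
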